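import Summits.NavierStokesRegularity.NavierStokesRegularity.Theorems.PerpetualPumpCircuitPumpActiveCoreGate

/-!
# Active block of the Toda pump over one period: the shift to the gate variables
# (crux `PerpetualPump.CircuitPump`, stmt-NavierStokesRegularity-1834; line `singular-clock-gspt`,
# helper `toda_active_shift` for the sub-goal `toda_active_core` of `stub_clockBox`)

The four active modes `(u, v, w, z)` of the seeded graded Toda pump over one window, in raw units
at the active scale (`u' = −u − v² + e²/lam − εuv`, `v' = v(u − w) − v + εu²`,
`w' = −νw + v² − lam z² − ε lam w z`, `z' = z(lam(w − y) − ν) + ε lam w²`, `ν = lam^{4/5}`,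
`0 ≤ e ≤ 1`, `|y| ≤ 1`, `z ≤ 1` given; section data `u(0) = A`, `v(0) = √ε`,
`w(0) ∈ [−ε², ε^{3/4}]`, `z(0) ∈ [0, ε^{3/2}]`). Everything about `(u, v, w)` follows from the
abstract period theorem `toda_gate_period` (`Theorems/PerpetualPumpCircuitPumpActiveCoreGate.lean`)
applied to the SHIFTED new carrier `W = w + ε² e^{−νt}` (so `W(0) ∈ [0, 1]`), with
`p = e²/lam − εuv`, `s = εu² + ε² e^{−νt} v`, `r = −lam z² − ε lam w z`, `P = 3`, `Ps = ε(A+2)²`: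
the sizes `|p|, |r| ≤ 3`, `0 ≤ s ≤ Ps` come from `z, v ≥ 0` (linear comparison) and the energy
`E = u² + v² + w²`, whose derivative along the flow has no cubic terms and is `≤ 4`
(`shift_pt_energy`), so `|u|, v, |w| ≤ A + 1`. The conclusions are translated back to `w` with
`|w − W| ≤ ε²` and the `1`-Lipschitz bound `gate_sqrt_shift_le` for the radius. [folklore]
-/

noncomputable section

-- the summit namespace `…NavierStokesRegularity.NavierStokesRegularity…` is the tree convention
set_option linter.dupNamespace false

namespace Summit.NavierStokesRegularity.NavierStokesRegularity.Theorems.PerpetualPumpCircuitPump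

open Set Filter Topology Literature.Analysis.ODE

/-- Numerics of the window parameters: `ν = lam^{4/5} ∈ [1, 3/2]`, `ε ≤ 10⁻⁴`, `εA² ≤ 1`,
`√ε ≤ 1/2`, `ε^{3/4} + ε² ≤ 1`, `ε^{3/2} ≤ ε`, the seed/bond ratio `32 ε(A+2)² ≤ A√ε`, and
`−log √ε = −(log ε)/2 ≤ A/10`. [folklore] -/
theorem shift_numerics {lam ν ε A : ℝ} (hlam1 : 1 < lam) (hlam2 : lam ≤ 3 / 2)
    (hν : ν = lam ^ (4 / 5 : ℝ)) (hε : 0 < ε) (hA : 40000 ≤ A) (hΛ : -Real.log ε ≤ A / 5)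
    (hεA : ε * (A + 2) ^ 2 ≤ 1) (hsεA : Real.sqrt ε * A ≤ 1 / 40) :
    1 ≤ ν ∧ ν ≤ 3 / 2 ∧ ε ^ 2 ≤ 1 / 10000 ∧ ε * A ^ 2 ≤ 1 ∧ ε * (A + 1) ≤ 1 ∧ ε ≤ 1 / 10000 ∧
      0 < Real.sqrt ε ∧ Real.sqrt ε ≤ 1 / 2 ∧ ε ^ (3 / 4 : ℝ) + ε ^ 2 ≤ 1 ∧ ε ^ (3 / 2 : ℝ) ≤ ε ∧
      32 * (ε * (A + 2) ^ 2) ≤ A * Real.sqrt ε ∧ -Real.log (Real.sqrt ε) ≤ A / 10 ∧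
      -(Real.log ε) / 2 + Real.log (A / 8) = Real.log (A / 8) - Real.log (Real.sqrt ε) := by
  have hA0 : 0 < A := by linarith
  have hν1 : 1 ≤ ν := by rw [hν]; exact Real.one_le_rpow hlam1.le (by norm_num)
  have hν2 : ν ≤ 3 / 2 := by
    rw [hν]; exact (Real.rpow_le_self_of_one_le hlam1.le (by norm_num)).trans hlam2
  have hεA2 : ε * A ^ 2 ≤ 1 := by nlinarith
  have hε4 : ε ≤ 1 / 10000 := by nlinarith
  have hε1 : ε ≤ 1 := by linarith
  have hε2 : ε ^ 2 ≤ 1 / 10000 := by nlinarith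
  have hεA1 : ε * (A + 1) ≤ 1 := by nlinarith
  have hs0 : 0 < Real.sqrt ε := Real.sqrt_pos.mpr hε
  have hs1 : Real.sqrt ε ≤ 1 / 2 := by nlinarith [mul_le_mul_of_nonneg_left hA hs0.le]
  have h34 : ε ^ (3 / 4 : ℝ) ≤ Real.sqrt ε := by
    rw [Real.sqrt_eq_rpow]
    exact Real.rpow_le_rpow_of_exponent_ge hε hε1 (by norm_num)
  have h32 : ε ^ (3 / 2 : ℝ) ≤ ε := by
    have := Real.rpow_le_rpow_of_exponent_ge hε hε1 (by norm_num : (1 : ℝ) ≤ 3 / 2)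
    rwa [Real.rpow_one] at this
  have hPsv : 32 * (ε * (A + 2) ^ 2) ≤ A * Real.sqrt ε := by
    have hsq : Real.sqrt ε ^ 2 = ε := Real.sq_sqrt hε.le
    have h1 : Real.sqrt ε * (32 * (A + 2) ^ 2) ≤ A := by
      nlinarith [mul_le_mul_of_nonneg_right hsεA hA0.le]
    calc 32 * (ε * (A + 2) ^ 2) = Real.sqrt ε * (Real.sqrt ε * (32 * (A + 2) ^ 2)) := by
          linear_combination (-(32 * (A + 2) ^ 2)) * hsq
      _ ≤ Real.sqrt ε * A := mul_le_mul_of_nonneg_left h1 hs0.le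
      _ = A * Real.sqrt ε := mul_comm _ _
  have hlog : Real.log (Real.sqrt ε) = Real.log ε / 2 := Real.log_sqrt hε.le
  refine ⟨hν1, hν2, hε2, hεA2, hεA1, hε4, hs0, hs1, by linarith, h32, hPsv, ?_, ?_⟩
  · rw [hlog]; linarith
  · rw [hlog]; ring

/-- **The energy has no cubic terms.** Along the active flow,
`(u² + v² + w²)' = −2u² − 2v² − 2νw² + 2u e²/lam − 2 lam w z² − 2ε lam w² z ≤ 4`
(`0 ≤ e ≤ 1`, `0 ≤ z ≤ 1`, `lam ∈ (1, 3/2]`, `ν ≥ 1`). [folklore] -/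
theorem shift_pt_energy {lam ν ε U V W Z E : ℝ} (hlam1 : 1 < lam) (hlam2 : lam ≤ 3 / 2)
    (hν1 : 1 ≤ ν) (hε : 0 < ε) (he0 : 0 ≤ E) (he1 : E ≤ 1) (hz0 : 0 ≤ Z) (hz1 : Z ≤ 1) :
    2 * U * (-U - V ^ 2 + lam⁻¹ * E ^ 2 - ε * U * V) + 2 * V * (V * (U - W) - V + ε * U ^ 2) +
      2 * W * (-ν * W + V ^ 2 - lam * Z ^ 2 - ε * lam * W * Z) ≤ 4 := by
  have hlam0 : 0 < lam := by linarith
  have hli : lam⁻¹ ≤ 1 := inv_le_one_of_one_le₀ hlam1.le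
  have hli0 : 0 ≤ lam⁻¹ := inv_nonneg.mpr hlam0.le
  have hE2 : E ^ 2 ≤ 1 := by nlinarith
  have ha0 : 0 ≤ lam⁻¹ * E ^ 2 := by positivity
  have ha1 : lam⁻¹ * E ^ 2 ≤ 1 := by nlinarith
  have hZ2 : Z ^ 2 ≤ 1 := by nlinarith
  have hb0 : 0 ≤ lam * Z ^ 2 := by positivity
  have hb1 : lam * Z ^ 2 ≤ 3 / 2 := by nlinarith
  have hc0 : 0 ≤ ε * lam * Z * W ^ 2 := by positivity
  have hνw : 0 ≤ (ν - 1) * W ^ 2 := mul_nonneg (by linarith) (sq_nonneg _)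
  nlinarith [sq_nonneg (U - lam⁻¹ * E ^ 2), sq_nonneg (W + lam * Z ^ 2), sq_nonneg V,
    mul_le_mul ha1 ha1 ha0 zero_le_one, mul_le_mul hb1 hb1 hb0 (by norm_num : (0 : ℝ) ≤ 3 / 2)]

/-- **Pointwise sizes of the perturbations of the shifted gate** from the energy bound
`u² + v² + w² ≤ A² + 4`: `|u|, v, |w| ≤ A + 1`, `|p| = |e²/lam − εuv| ≤ 3`,
`|r| = |−lam z² − ε lam w z| ≤ 3`, `0 ≤ s = εu² + ε² e^{−νt} v ≤ ε(A + 2)²`. [folklore] -/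
theorem shift_pt_pert {lam ν ε A t U V W Z E : ℝ} (hlam1 : 1 < lam) (hlam2 : lam ≤ 3 / 2)
    (hν1 : 1 ≤ ν) (hε : 0 < ε) (hA : 40000 ≤ A) (hεA2 : ε * A ^ 2 ≤ 1)
    (hεA1 : ε * (A + 1) ≤ 1) (ht : 0 ≤ t) (hE : U ^ 2 + V ^ 2 + W ^ 2 ≤ A ^ 2 + 4) (hV0 : 0 ≤ V)
    (he0 : 0 ≤ E) (he1 : E ≤ 1) (hz0 : 0 ≤ Z) (hz1 : Z ≤ 1) :
    |lam⁻¹ * E ^ 2 - ε * U * V| ≤ 3 ∧ |-lam * Z ^ 2 - ε * lam * W * Z| ≤ 3 ∧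
      (0 ≤ ε * U ^ 2 + ε ^ 2 * Real.exp (-ν * t) * V ∧
        ε * U ^ 2 + ε ^ 2 * Real.exp (-ν * t) * V ≤ ε * (A + 2) ^ 2) ∧
      |U| ≤ A + 1 ∧ V ≤ A + 1 ∧ |W| ≤ A + 1 := by
  have hA1 : (0 : ℝ) ≤ A + 1 := by linarith
  have hU : |U| ≤ A + 1 := abs_le_of_sq_le_sq (by nlinarith [sq_nonneg V, sq_nonneg W]) hA1
  have hVb : |V| ≤ A + 1 := abs_le_of_sq_le_sq (by nlinarith [sq_nonneg U, sq_nonneg W]) hA1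
  have hWb : |W| ≤ A + 1 := abs_le_of_sq_le_sq (by nlinarith [sq_nonneg U, sq_nonneg V]) hA1
  have hV1 : V ≤ A + 1 := (le_abs_self V).trans hVb
  have hlam0 : 0 < lam := by linarith
  have hli : lam⁻¹ ≤ 1 := inv_le_one_of_one_le₀ hlam1.le
  have hli0 : 0 ≤ lam⁻¹ := inv_nonneg.mpr hlam0.le
  have hE2 : E ^ 2 ≤ 1 := by nlinarith
  have ha0 : 0 ≤ lam⁻¹ * E ^ 2 := by positivity
  have ha1 : lam⁻¹ * E ^ 2 ≤ 1 := by nlinarith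
  refine ⟨?_, ?_, ⟨by positivity, ?_⟩, hU, hV1, hWb⟩
  · have huv : |U * V| ≤ (A ^ 2 + 4) / 2 := by
      rw [abs_le]
      constructor <;> nlinarith [sq_nonneg (U + V), sq_nonneg (U - V), sq_nonneg W]
    have h1 : |ε * U * V| ≤ 1 := by
      rw [mul_assoc, abs_mul, abs_of_pos hε]
      calc ε * |U * V| ≤ ε * ((A ^ 2 + 4) / 2) := mul_le_mul_of_nonneg_left huv hε.le
        _ ≤ 1 := by nlinarith
    obtain ⟨h1a, h1b⟩ := abs_le.mp h1
    rw [abs_le]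
    constructor <;> linarith
  · have hZ2 : Z ^ 2 ≤ 1 := by nlinarith
    have hb0 : 0 ≤ lam * Z ^ 2 := by positivity
    have hb1 : lam * Z ^ 2 ≤ 3 / 2 := by nlinarith
    have h3 : |ε * lam * W * Z| ≤ 3 / 2 := by
      rw [abs_mul, abs_mul, abs_mul, abs_of_pos hε, abs_of_pos hlam0, abs_of_nonneg hz0]
      calc ε * lam * |W| * Z ≤ ε * (3 / 2) * (A + 1) * 1 := by
            apply mul_le_mul _ hz1 hz0 (by positivity)
            apply mul_le_mul _ hWb (abs_nonneg _) (by positivity)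
            exact mul_le_mul_of_nonneg_left hlam2 hε.le
        _ ≤ 3 / 2 := by nlinarith
    obtain ⟨h3a, h3b⟩ := abs_le.mp h3
    rw [abs_le]
    constructor <;> linarith
  · have he0' := Real.exp_pos (-ν * t)
    have he1' : Real.exp (-ν * t) ≤ 1 :=
      Real.exp_le_one_iff.mpr (by nlinarith)
    have h1 : ε ^ 2 * Real.exp (-ν * t) * V ≤ ε ^ 2 * 1 * (A + 1) :=
      mul_le_mul (mul_le_mul_of_nonneg_left he1' (sq_nonneg ε)) hV1 hV0 (by positivity)
    have h2 : ε * U ^ 2 ≤ ε * (A ^ 2 + 4) :=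
      mul_le_mul_of_nonneg_left (by nlinarith [sq_nonneg V, sq_nonneg W]) hε.le
    have h3 : ε * (ε * (A + 1)) ≤ ε * 1 := mul_le_mul_of_nonneg_left hεA1 hε.le
    have h4 : ε * 1 ≤ ε * A := mul_le_mul_of_nonneg_left (by linarith) hε.le
    linarith

/-- **THE ACTIVE BLOCK IN GATE VARIABLES (shift lemma).** Under the hypotheses of
`toda_active_core`: the global brackets (i) (energy, `z, v ≥ 0`, and `toda_gate_period` (i));
the gate time `tg ∈ [τ⁻, τ⁺]` with the rise brackets on `[0, tg]`; the flipped gate, bond decay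
and `w ≥ 3A/10 − 1` on `[τ⁺ + 250/A, T]`; the radius at `t₃`; and the post-`t₃` pinning — all for
the UNSHIFTED carrier `w`, obtained from `toda_gate_period` for `W = w + ε² e^{−νt}` and the
translation `|w − W| ≤ ε²`, `|R − R̃| ≤ ε²`. [folklore] -/
theorem toda_active_shift :
    ∀ (lam ν ε A T : ℝ) (u v w z e y : ℝ → ℝ),
    1 < lam → lam ≤ 3 / 2 → ν = lam ^ (4 / 5 : ℝ) → 0 < ε → 0 < T → T ≤ 1 / 2 →
    40000 ≤ A → -Real.log ε ≤ A / 5 → ε * (A + 2) ^ 2 ≤ 1 → Real.sqrt ε * A ≤ 1 / 40 →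
    (-Real.log (1 - (-(Real.log ε) / 2 + Real.log (A / 8) + 11 / 5) / A) + (250 + 16 * Real.log A) / A) ≤ T →
    u 0 = A → v 0 = Real.sqrt ε → -ε ^ 2 ≤ w 0 → w 0 ≤ ε ^ (3 / 4 : ℝ) → 0 ≤ z 0 → z 0 ≤ ε ^ (3 / 2 : ℝ) →
    ContinuousOn u (Set.Icc 0 T) → ContinuousOn v (Set.Icc 0 T) → ContinuousOn w (Set.Icc 0 T) →
    ContinuousOn z (Set.Icc 0 T) → ContinuousOn e (Set.Icc 0 T) → ContinuousOn y (Set.Icc 0 T) →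
    (∀ t ∈ Set.Ico 0 T, HasDerivWithinAt u
      (-u t - v t ^ 2 + lam⁻¹ * e t ^ 2 - ε * u t * v t) (Set.Ici t) t) →
    (∀ t ∈ Set.Ico 0 T, HasDerivWithinAt v (v t * (u t - w t) - v t + ε * u t ^ 2) (Set.Ici t) t) →
    (∀ t ∈ Set.Ico 0 T, HasDerivWithinAt w
      (-ν * w t + v t ^ 2 - lam * z t ^ 2 - ε * lam * w t * z t) (Set.Ici t) t) →
    (∀ t ∈ Set.Ico 0 T, HasDerivWithinAt z
      (z t * (lam * (w t - y t) - ν) + ε * lam * w t ^ 2) (Set.Ici t) t) →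
    (∀ t ∈ Set.Icc 0 T, 0 ≤ e t ∧ e t ≤ 1) → (∀ t ∈ Set.Icc 0 T, |y t| ≤ 1) →
    (∀ t ∈ Set.Icc 0 T, z t ≤ 1) →
    (∀ t ∈ Set.Icc 0 T, 0 ≤ v t ∧ v t ≤ A + 1 ∧ -10 ≤ u t ∧ u t ≤ A + 1 ∧ -2 ≤ w t ∧ w t ≤ A + 1 ∧
      0 ≤ z t ∧ A / 4 ≤ Real.sqrt ((u t - w t) ^ 2 + 2 * v t ^ 2)) ∧
    ∃ tg : ℝ, (-Real.log (1 - (-(Real.log ε) / 2 + Real.log (A / 8) - 6 / 5) / A)) ≤ tg ∧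
      tg ≤ (-Real.log (1 - (-(Real.log ε) / 2 + Real.log (A / 8) + 11 / 5) / A)) ∧ 0 ≤ tg ∧
      (-Real.log (1 - (-(Real.log ε) / 2 + Real.log (A / 8) + 11 / 5) / A) + (250 + 16 * Real.log A) / A) ≤
        tg + (255 + 16 * Real.log A) / A ∧
      v tg = A / 8 ∧
      (∀ t ∈ Set.Icc 0 tg, v 0 ≤ v t ∧ v t ≤ A / 8 ∧ A / 2 + 1 ≤ u t - w t ∧ w t ≤ A / 64 + 5 / 2) ∧
      (∀ t ∈ Set.Icc ((-Real.log (1 - (-(Real.log ε) / 2 + Real.log (A / 8) + 11 / 5) / A)) + 250 / A) T,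
        u t - w t ≤ -(4 / 5) * Real.sqrt ((u t - w t) ^ 2 + 2 * v t ^ 2) ∧
        v t ≤ A * Real.exp (-(A / 4) * (t - ((-Real.log (1 - (-(Real.log ε) / 2 + Real.log (A / 8) + 11 / 5) / A)) + 250 / A))) +
          30 / A ∧ 3 * A / 10 - 1 ≤ w t) ∧
      |Real.sqrt ((u (-Real.log (1 - (-(Real.log ε) / 2 + Real.log (A / 8) + 11 / 5) / A) + (250 + 16 * Real.log A) / A) - w (-Real.log (1 - (-(Real.log ε) / 2 + Real.log (A / 8) + 11 / 5) / A) + (250 + 16 * Real.log A) / A)) ^ 2 + 2 * v (-Real.log (1 - (-(Real.log ε) / 2 + Real.log (A / 8) + 11 / 5) / A) + (250 + 16 * Real.log A) / A) ^ 2) -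
          A * Real.exp (-tg)| ≤ 900 + 50 * Real.log A ∧
      (∀ t ∈ Set.Icc (-Real.log (1 - (-(Real.log ε) / 2 + Real.log (A / 8) + 11 / 5) / A) + (250 + 16 * Real.log A) / A) T,
        |w t - Real.sqrt ((u (-Real.log (1 - (-(Real.log ε) / 2 + Real.log (A / 8) + 11 / 5) / A) + (250 + 16 * Real.log A) / A) - w (-Real.log (1 - (-(Real.log ε) / 2 + Real.log (A / 8) + 11 / 5) / A) + (250 + 16 * Real.log A) / A)) ^ 2 + 2 * v (-Real.log (1 - (-(Real.log ε) / 2 + Real.log (A / 8) + 11 / 5) / A) + (250 + 16 * Real.log A) / A) ^ 2) *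
          Real.exp (-ν * (t - (-Real.log (1 - (-(Real.log ε) / 2 + Real.log (A / 8) + 11 / 5) / A) + (250 + 16 * Real.log A) / A)))| ≤ 30 ∧
        v t ≤ 2 ∧ |u t| ≤ 13) := by
  intro lam ν ε A T u v w z e y hlam1 hlam2 hν hε hT0 hT hA hΛ hεA hsεA ht3T hu0 hv0 hw0lo hw0hi
    hz0 _ hu hv hw hz _ hy hu' hv' hw' hz' heb _ hzb
  set τp : ℝ := -Real.log (1 - (-(Real.log ε) / 2 + Real.log (A / 8) + 11 / 5) / A) with hτp
  set τm : ℝ := -Real.log (1 - (-(Real.log ε) / 2 + Real.log (A / 8) - 6 / 5) / A) with hτm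
  set t₃ : ℝ := τp + (250 + 16 * Real.log A) / A with ht₃
  obtain ⟨hν1, hν2, hε2, hεA2, hεA1, hε4, hsε0, hsε1, h34, -, hPsv, hlogv, hℓ⟩ :=
    shift_numerics hlam1 hlam2 hν hε hA hΛ hεA hsεA
  have hA0 : 0 < A := by linarith only [hA]
  have hlam0 : 0 < lam := by linarith only [hlam1]
  have hv0pos : 0 < v 0 := by rw [hv0]; exact hsε0
  have hlogA0 : 0 ≤ Real.log A := Real.log_nonneg (by linarith only [hA])
  have h250A : (0 : ℝ) ≤ 250 / A := by positivity
  have hτpt₃ : τp + 250 / A ≤ t₃ := by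
    rw [ht₃, add_div]
    linarith only [div_nonneg (by positivity : (0 : ℝ) ≤ 16 * Real.log A) hA0.le]
  -- z ≥ 0 and v ≥ 0 (variable-coefficient linear comparison with non-negative sources)
  have hzv : ∀ t ∈ Icc 0 T, 0 ≤ z t ∧ 0 ≤ v t := fun t ht =>
    ⟨nonneg_of_mul_le_deriv_right (β := fun x => lam * (w x - y x) - ν) hz hz'
        ((continuousOn_const.mul (hw.sub hy)).sub continuousOn_const)
        (fun x _ => by
          have h1 : 0 ≤ ε * lam * w x ^ 2 := by positivity
          show (lam * (w x - y x) - ν) * z x ≤ _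
          linarith only [h1]) hz0 ht,
      nonneg_of_mul_le_deriv_right (β := fun x => u x - w x - 1) hv hv'
        ((hu.sub hw).sub continuousOn_const)
        (fun x _ => by
          have h1 : 0 ≤ ε * u x ^ 2 := by positivity
          show (u x - w x - 1) * v x ≤ _
          linarith only [h1]) (by rw [hv0]; exact hsε0.le) ht⟩
  -- the energy bound
  have hE : ∀ t ∈ Icc 0 T, u t ^ 2 + v t ^ 2 + w t ^ 2 ≤ A ^ 2 + 4 := by
    intro t ht
    have hE' : ∀ x ∈ Ico 0 T, HasDerivWithinAt (fun y => u y ^ 2 + v y ^ 2 + w y ^ 2)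
        (2 * u x * (-u x - v x ^ 2 + lam⁻¹ * e x ^ 2 - ε * u x * v x) +
          2 * v x * (v x * (u x - w x) - v x + ε * u x ^ 2) +
          2 * w x * (-ν * w x + v x ^ 2 - lam * z x ^ 2 - ε * lam * w x * z x)) (Ici x) x :=
      fun x hx => by
        refine ((((hu' x hx).fun_pow 2).add ((hv' x hx).fun_pow 2)).add
          ((hw' x hx).fun_pow 2)).congr_deriv ?_
        norm_num
    have h := sub_le_mul_of_deriv_right_le (f := fun y => u y ^ 2 + v y ^ 2 + w y ^ 2) (M := 4)
      (a := 0) (b := T)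
      (((hu.fun_pow 2).add (hv.fun_pow 2)).add (hw.fun_pow 2)) hE' (fun x hx => by
        have hx' := Ico_subset_Icc_self hx
        exact shift_pt_energy hlam1 hlam2 hν1 hε (heb x hx').1 (heb x hx').2 (hzv x hx').1
          (hzb x hx')) t ht
    have hsq : Real.sqrt ε ^ 2 = ε := Real.sq_sqrt hε.le
    have hw02 : w 0 ^ 2 ≤ 1 := by
      have h1 : -1 ≤ w 0 := by linarith only [hw0lo, hε2]
      have h2 : w 0 ≤ 1 := by linarith only [hw0hi, h34, sq_nonneg ε]
      nlinarith only [h1, h2]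
    have e0 : u 0 ^ 2 + v 0 ^ 2 + w 0 ^ 2 ≤ A ^ 2 + 2 := by
      rw [hu0, hv0, hsq]; linarith only [hw02, hε4]
    simp only [sub_zero] at h
    linarith only [h, e0, ht.2, hT]
  -- sizes of the perturbations
  have hB : ∀ t ∈ Icc 0 T, |lam⁻¹ * e t ^ 2 - ε * u t * v t| ≤ 3 ∧
      |-lam * z t ^ 2 - ε * lam * w t * z t| ≤ 3 ∧
      (0 ≤ ε * u t ^ 2 + ε ^ 2 * Real.exp (-ν * t) * v t ∧
        ε * u t ^ 2 + ε ^ 2 * Real.exp (-ν * t) * v t ≤ ε * (A + 2) ^ 2) ∧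
      |u t| ≤ A + 1 ∧ v t ≤ A + 1 ∧ |w t| ≤ A + 1 := fun t ht =>
    shift_pt_pert hlam1 hlam2 hν1 hε hA hεA2 hεA1 ht.1 (hE t ht) (hzv t ht).2 (heb t ht).1
      (heb t ht).2 (hzv t ht).1 (hzb t ht)
  -- the shifted new carrier
  set W : ℝ → ℝ := fun t => w t + ε ^ 2 * Real.exp (-ν * t) with hWdef
  have hWw : ∀ t, 0 ≤ t → w t ≤ W t ∧ W t ≤ w t + ε ^ 2 := fun t ht => by
    have h1 : Real.exp (-ν * t) ≤ 1 := Real.exp_le_one_iff.mpr (by nlinarith only [hν1, ht])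
    have h2 : 0 ≤ ε ^ 2 * Real.exp (-ν * t) := by positivity
    have h3 : ε ^ 2 * Real.exp (-ν * t) ≤ ε ^ 2 * 1 := mul_le_mul_of_nonneg_left h1 (sq_nonneg ε)
    simp only [hWdef]
    constructor <;> linarith only [h2, h3]
  have hWc : ContinuousOn W (Icc 0 T) := hw.add (by fun_prop)
  have hW0 : 0 ≤ W 0 ∧ W 0 ≤ 1 := by
    simp only [hWdef, mul_zero, Real.exp_zero, mul_one]
    constructor <;> linarith only [hw0lo, hw0hi, h34, hsε1]
  have hu'' : ∀ t ∈ Ico 0 T, HasDerivWithinAt u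
      (-u t - v t ^ 2 + (lam⁻¹ * e t ^ 2 - ε * u t * v t)) (Ici t) t :=
    fun t ht => (hu' t ht).congr_deriv (by ring)
  have hv'' : ∀ t ∈ Ico 0 T, HasDerivWithinAt v
      (v t * (u t - W t) - v t + (ε * u t ^ 2 + ε ^ 2 * Real.exp (-ν * t) * v t)) (Ici t) t :=
    fun t ht => (hv' t ht).congr_deriv (by simp only [hWdef]; ring)
  have hW' : ∀ t ∈ Ico 0 T, HasDerivWithinAt W
      (-ν * W t + v t ^ 2 + (-lam * z t ^ 2 - ε * lam * w t * z t)) (Ici t) t :=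
    fun t ht => ((hw' t ht).add ((((hasDerivAt_id' t).const_mul (-ν)).exp.const_mul
      (ε ^ 2)).hasDerivWithinAt)).congr_deriv (by simp only [hWdef]; ring)
  -- the abstract period theorem for (u, v, W)
  obtain ⟨hIa, tg, htgm, htgp, htg0, ht3tg, hvtg, hrise, hIIIa, hIVa, hVa⟩ :=
    toda_gate_period ν (ε * (A + 2) ^ 2) T A (-(Real.log ε) / 2 + Real.log (A / 8)) τm τp t₃
      u v W (fun t => lam⁻¹ * e t ^ 2 - ε * u t * v t)
      (fun t => -lam * z t ^ 2 - ε * lam * w t * z t)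
      (fun t => ε * u t ^ 2 + ε ^ 2 * Real.exp (-ν * t) * v t)
      hν1 hν2 (by positivity) (by linarith only [hεA]) hT0 hT hA hu0 hW0.1 hW0.2 hv0pos
      (by rw [hv0]; linarith only [hsε1]) (by rw [hv0]; exact hPsv) (by rw [hv0]; exact hlogv)
      (by rw [hv0]; exact hℓ) hτm hτp ht₃ ht3T hu hv hWc hu'' hv'' hW'
      (fun t ht => (hB t ht).1) (fun t ht => (hB t ht).2.1) (fun t ht => (hB t ht).2.2.1)
  -- translation back to `w`
  have hRR : ∀ t, 0 ≤ t → |Real.sqrt ((u t - w t) ^ 2 + 2 * v t ^ 2) -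
      Real.sqrt ((u t - W t) ^ 2 + 2 * v t ^ 2)| ≤ ε ^ 2 := fun t ht => by
    obtain ⟨h1, h2⟩ := hWw t ht
    have hc : 0 ≤ 2 * v t ^ 2 := by positivity
    have e1 := gate_sqrt_shift_le (u t) (w t) (W t) (2 * v t ^ 2) hc
    have e2 := gate_sqrt_shift_le (u t) (W t) (w t) (2 * v t ^ 2) hc
    have hwW : |w t - W t| ≤ ε ^ 2 := by
      rw [abs_le]; constructor <;> linarith only [h1, h2]
    rw [abs_sub_comm] at e2
    rw [abs_le]
    constructor <;> linarith only [e1, e2, hwW]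
  have htgT : tg ≤ T := by linarith only [htgp, hτpt₃, ht3T, h250A]
  have ht₃0 : 0 ≤ t₃ := by linarith only [htg0, htgp, hτpt₃, h250A]
  have hI : ∀ t ∈ Icc 0 T, 0 ≤ v t ∧ v t ≤ A + 1 ∧ -10 ≤ u t ∧ u t ≤ A + 1 ∧ -2 ≤ w t ∧
      w t ≤ A + 1 ∧ 0 ≤ z t ∧ A / 4 ≤ Real.sqrt ((u t - w t) ^ 2 + 2 * v t ^ 2) := by
    intro t ht
    obtain ⟨hz0t, hv0t⟩ := hzv t ht
    obtain ⟨-, -, -, hub, hvb, hwb⟩ := hB t ht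
    obtain ⟨-, hulo, -, hWlo, -, hR3⟩ := hIa t ht
    obtain ⟨-, hw2⟩ := hWw t ht.1
    obtain ⟨hR1, -⟩ := abs_le.mp (hRR t ht.1)
    exact ⟨hv0t, hvb, hulo, (le_abs_self _).trans hub, by linarith only [hWlo, hw2, hε2],
      (le_abs_self _).trans hwb, hz0t, by linarith only [hR3, hR1, hε2, hA]⟩
  have hriseX : ∀ t ∈ Icc 0 tg, v 0 ≤ v t ∧ v t ≤ A / 8 ∧ A / 2 + 1 ≤ u t - w t ∧
      w t ≤ A / 64 + 5 / 2 := by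
    intro t ht
    obtain ⟨h1, h2, h3, h4⟩ := hrise t ht
    obtain ⟨hw1, -⟩ := hWw t ht.1
    have hv0t := (hzv t ⟨ht.1, ht.2.trans htgT⟩).2
    have hv2 : v t ^ 2 / A ≤ A / 64 := by
      rw [div_le_iff₀ hA0]
      nlinarith only [pow_le_pow_left₀ hv0t h2 2]
    exact ⟨h1, h2, by linarith only [h3, hw1], by linarith only [h4, hw1, hv2, ht.2, htgT, hT]⟩
  have hIIIX : ∀ t ∈ Icc (τp + 250 / A) T,
      u t - w t ≤ -(4 / 5) * Real.sqrt ((u t - w t) ^ 2 + 2 * v t ^ 2) ∧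
      v t ≤ A * Real.exp (-(A / 4) * (t - (τp + 250 / A))) + 30 / A ∧ 3 * A / 10 - 1 ≤ w t := by
    intro t ht
    have ht0 : 0 ≤ t := by linarith only [ht.1, htg0, htgp, h250A]
    obtain ⟨hDf, hvf, hWf⟩ := hIIIa t ht
    obtain ⟨-, hw2⟩ := hWw t ht0
    obtain ⟨-, hR2⟩ := abs_le.mp (hRR t ht0)
    obtain ⟨-, -, -, -, -, -, -, hR4⟩ := hI t ⟨ht0, ht.2⟩
    have h30 : 24 / A ≤ 30 / A := div_le_div_of_nonneg_right (by norm_num) hA0.le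
    exact ⟨by linarith only [hDf, hw2, hR2, hR4, hε2, hA], by linarith only [hvf, h30],
      by linarith only [hWf, hw2, hε2]⟩
  have hIVX : |Real.sqrt ((u t₃ - w t₃) ^ 2 + 2 * v t₃ ^ 2) - A * Real.exp (-tg)| ≤
      900 + 50 * Real.log A := by
    obtain ⟨hR1, hR2⟩ := abs_le.mp (hRR t₃ ht₃0)
    obtain ⟨h1, h2⟩ := abs_le.mp hIVa
    rw [abs_le]
    constructor <;> linarith only [hR1, hR2, h1, h2, hε2, hlogA0]
  have hVX : ∀ t ∈ Icc t₃ T, |w t - Real.sqrt ((u t₃ - w t₃) ^ 2 + 2 * v t₃ ^ 2) *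
      Real.exp (-ν * (t - t₃))| ≤ 30 ∧ v t ≤ 2 ∧ |u t| ≤ 13 := by
    intro t ht
    obtain ⟨hWt, hvt, hut⟩ := hVa t ht
    have ht0 : 0 ≤ t := ht₃0.trans ht.1
    obtain ⟨hw1, hw2⟩ := hWw t ht0
    have he0 := Real.exp_pos (-ν * (t - t₃))
    have he1 : Real.exp (-ν * (t - t₃)) ≤ 1 :=
      Real.exp_le_one_iff.mpr (by nlinarith only [hν1, ht.1])
    have h1 : |Real.sqrt ((u t₃ - w t₃) ^ 2 + 2 * v t₃ ^ 2) * Real.exp (-ν * (t - t₃)) -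
        Real.sqrt ((u t₃ - W t₃) ^ 2 + 2 * v t₃ ^ 2) * Real.exp (-ν * (t - t₃))| ≤ ε ^ 2 := by
      rw [← sub_mul, abs_mul, abs_of_pos he0]
      calc _ ≤ ε ^ 2 * 1 := mul_le_mul (hRR t₃ ht₃0) he1 he0.le (sq_nonneg ε)
        _ = ε ^ 2 := mul_one _
    obtain ⟨h1a, h1b⟩ := abs_le.mp h1
    obtain ⟨h2a, h2b⟩ := abs_le.mp hWt
    refine ⟨?_, by linarith only [hvt], hut.trans (by norm_num)⟩
    rw [abs_le]
    constructor <;> linarith only [h1a, h1b, h2a, h2b, hw1, hw2, hε2]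
  exact ⟨hI, tg, htgm, htgp, htg0, ht3tg, hvtg, hriseX, hIIIX, hIVX, hVX⟩

end Summit.NavierStokesRegularity.NavierStokesRegularity.Theorems.PerpetualPumpCircuitPump
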